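import Mathlib
import Summits.NavierStokesRegularity.NavierStokesRegularity.Theorems.EulerZoomLiouvillePowerGaugeEulerLiouvilleSelfSimilarEndpointFlux
import HarnessLib

/-!
# Rung C1 of the crux `EulerZoomLiouville.PowerGaugeEulerLiouville` inside the window: no self-similar
# Euler collapse without INWARD energy flux — profile-level tools

Route №10 `EulerZoomLiouville` (NavierStokesRegularity), crux E = stmt-NavierStokesRegularity-19832,
tenure rung C1 (exactly self-similar members).  Seat ns-typeII-p2 g3 (cell ns-regularity-ideate §B).
First of two files (sequel: `…SelfSimilarOutgoing.lean`, the member-level stratum).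

For an exactly self-similar member `u(τ,x) = (−τ)^{γ−1} V((−τ)^{−γ} x)`,
`p(τ,x) = (−τ)^{2(γ−1)} P((−τ)^{−γ} x)` (`γ = 1/(2+ρ)`) of Seregin's power-gauged ancient Euler class,
the tree hands the profile `(V, P)` the FORWARD profile local energy inequality
(`selfSimilar_profile_energy_le_add_flux`): the smoothed, normalised enclosed energy
`Φ_σ(τ) = (−τ)^{5γ−2} ∫ |V|² σ((−τ)^γ ·)` — which is the physical local energy `∫ |u(τ,x)|² σ(x) dx` at
time `τ` — can only grow, as `τ ↑ 0`, through the flux `∫ (|V|² + 2P) ⟪V, ∇σ((−τ)^γ ·)⟫`.  For a radially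
non-increasing cutoff `σ` the gradient points inward (`∇σ(z) = −k(z) z`, `k ≥ 0`), so the flux integrand
is `−k · (|V|² + 2P) ⟪V, y⟫`: energy enters exactly where the Bernoulli flux `(|V|²/2 + P) ⟪V, y⟫` is
INWARD (negative).  This file proves the profile-level statement:

* `exists_radialCutoff` — a smooth radial cutoff `σ` (`= 1` on `B̄_1`, `= 0` off `B_2`, `0 ≤ σ ≤ 1`)
  with `⟪w, ∇σ(z)⟫ = −k(z) ⟪w, z⟫`, `k ≥ 0` (explicitly `σ(z) = smoothTransition((4 − |z|²)/3)`);
* `profileFlux_nonpos` — outward Bernoulli flux a.e. on `B_{r₀}` makes the flux term `≤ 0` at every scale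
  `2(−τ)^{−γ} < r₀`;
* `profile_ae_eq_zero_of_outgoingFlux` — any exponent `γ > 0`: if `(V, P)` satisfies the forward profile
  local energy inequality for such a `σ`, `|V|² ∈ L¹_loc`, the normalised enclosed energy is `≤ ε`
  frequently in every far past (`∃ᵐ τ < −T`), and the Bernoulli flux is OUTWARD a.e. on a ball,
  `0 ≤ (|V(y)|² + 2P(y)) ⟪V(y), y⟫` for a.e. `|y| < r₀`, then `V = 0` a.e. on `B_{r₀/2}` (a.e.
  monotonicity of `Φ` below the threshold scale + far-past smallness ⇒ `Φ = 0` a.e. ⇒ `V = 0` on the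
  balls `B_{(−τ)^{−γ}}`, which exhaust `B_{r₀/2}`).

WHAT THIS IS NOT: not NS, not E, not rung C1 — real-analysis half of an in-window stratum `--supports`
19832. [folklore]
-/

noncomputable section

-- flat `Theorems/<Route><Decl>…` files of one crux share the namespace of the crux (tree convention)
set_option linter.dupNamespace false

open MeasureTheory Set Filter Topology Metric Function
open scoped ENNReal NNReal InnerProductSpace RealInnerProductSpace

namespace Summit.NavierStokesRegularity.NavierStokesRegularity.Theorems.PowerGaugeEulerLiouville


/-! ## A radial cutoff with inward gradient -/

section Cutoff

/-- **A smooth radial cutoff with inward-pointing gradient.**  There is `σ : ℝ³ → ℝ`, smooth,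
compactly supported, `0 ≤ σ ≤ 1`, `σ = 1` on `B̄_1`, `σ = 0` off `B_2`, whose gradient is a
non-positive multiple of the position: `⟪w, ∇σ(z)⟫ = −k(z) ⟪w, z⟫` with `k ≥ 0`
(`σ(z) = smoothTransition((4 − |z|²)/3)`, `k(z) = (2/3) smoothTransition'((4 − |z|²)/3)`). [folklore] -/
theorem exists_radialCutoff :
    ∃ σ : EuclideanSpace ℝ (Fin 3) → ℝ, ContDiff ℝ (⊤ : ℕ∞) σ ∧ HasCompactSupport σ ∧
      (∀ z, 0 ≤ σ z) ∧ (∀ z, σ z ≤ 1) ∧ (∀ z, ‖z‖ ≤ 1 → σ z = 1) ∧ (∀ z, 2 ≤ ‖z‖ → σ z = 0) ∧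
      ∃ k : EuclideanSpace ℝ (Fin 3) → ℝ, (∀ z, 0 ≤ k z) ∧
        ∀ z w : EuclideanSpace ℝ (Fin 3), ⟪w, gradient σ z⟫ = -(k z * ⟪w, z⟫) := by
  set h : EuclideanSpace ℝ (Fin 3) → ℝ := fun z => (4 - ‖z‖ ^ 2) / 3 with hh
  set σ : EuclideanSpace ℝ (Fin 3) → ℝ := fun z => Real.smoothTransition (h z) with hσ
  have hhd : ∀ z : EuclideanSpace ℝ (Fin 3),
      HasFDerivAt h ((-(1 / 3 : ℝ)) • (innerSL ℝ z + innerSL ℝ z)) z := by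
    intro z
    have h1 : HasFDerivAt (fun z : EuclideanSpace ℝ (Fin 3) => ‖z‖ ^ 2) (innerSL ℝ z + innerSL ℝ z) z := by
      simpa only [two_nsmul] using (hasStrictFDerivAt_norm_sq z).hasFDerivAt
    have h2 := (h1.const_smul (-(1 / 3 : ℝ))).const_add (4 / 3 : ℝ)
    refine h2.congr_of_eventuallyEq (Eventually.of_forall fun y => ?_)
    simp only [hh, Pi.smul_apply, smul_eq_mul]
    ring
  have hσd : ∀ z : EuclideanSpace ℝ (Fin 3), HasFDerivAt σ
      (deriv Real.smoothTransition (h z) • ((-(1 / 3 : ℝ)) • (innerSL ℝ z + innerSL ℝ z))) z := by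
    intro z
    have hg : HasDerivAt Real.smoothTransition (deriv Real.smoothTransition (h z)) (h z) :=
      (((Real.smoothTransition.contDiff (n := 1)).differentiable one_ne_zero) _).hasDerivAt
    exact hg.comp_hasFDerivAt z (hhd z)
  have hzero : ∀ z : EuclideanSpace ℝ (Fin 3), 2 ≤ ‖z‖ → σ z = 0 := by
    intro z hz
    show Real.smoothTransition (h z) = 0
    refine Real.smoothTransition.zero_of_nonpos ?_
    simp only [hh]
    have : (4 : ℝ) ≤ ‖z‖ ^ 2 := by nlinarith [norm_nonneg z]
    linarith
  refine ⟨σ, ?_, ?_, fun z => Real.smoothTransition.nonneg _, fun z => Real.smoothTransition.le_one _,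
    fun z hz => ?_, hzero, ?_⟩
  · exact Real.smoothTransition.contDiff.comp
      ((contDiff_const.sub (contDiff_norm_sq ℝ)).div_const _)
  · refine HasCompactSupport.of_support_subset_isCompact
      (isCompact_closedBall (0 : EuclideanSpace ℝ (Fin 3)) 2) fun z hz => ?_
    rw [mem_closedBall, dist_zero_right]
    by_contra hcon
    exact hz (hzero z (not_le.1 hcon).le)
  · show Real.smoothTransition (h z) = 1
    refine Real.smoothTransition.one_of_one_le ?_
    simp only [hh]
    have : ‖z‖ ^ 2 ≤ 1 := by nlinarith [norm_nonneg z]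
    linarith
  · refine ⟨fun z => 2 / 3 * deriv Real.smoothTransition (h z), fun z =>
      mul_nonneg (by norm_num) Real.smoothTransition.monotone.deriv_nonneg, fun z w => ?_⟩
    rw [real_inner_comm, _root_.inner_gradient_left, (hσd z).fderiv]
    simp only [smul_apply, add_apply, innerSL_apply_apply, smul_eq_mul, real_inner_comm z w]
    ring

end Cutoff

/-! ## Profile level -/

section Profile

variable {γ : ℝ} {V : EuclideanSpace ℝ (Fin 3) → EuclideanSpace ℝ (Fin 3)}
  {P : EuclideanSpace ℝ (Fin 3) → ℝ} {σ : EuclideanSpace ℝ (Fin 3) → ℝ}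

/-- The normalised, smoothed enclosed energy `Φ(τ) = (−τ)^{5γ−2} ∫ |V|² σ((−τ)^γ ·)` of a profile is
non-negative (`σ ≥ 0`, `τ < 0`). [folklore] -/
theorem profileEnergy_nonneg (hσ0 : ∀ z, 0 ≤ σ z) {τ : ℝ} (hτ : τ < 0) :
    0 ≤ (-τ) ^ (5 * γ - 2) * ∫ y, ‖V y‖ ^ 2 * σ ((-τ) ^ γ • y) :=
  mul_nonneg (Real.rpow_nonneg (neg_pos.2 hτ).le _)
    (integral_nonneg fun _ => mul_nonneg (sq_nonneg _) (hσ0 _))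

/-- A function vanishing off `B_2` has zero gradient outside `B̄_2`. [folklore] -/
theorem gradient_eq_zero_of_two_lt (hσzero : ∀ z : EuclideanSpace ℝ (Fin 3), 2 ≤ ‖z‖ → σ z = 0)
    {z : EuclideanSpace ℝ (Fin 3)} (hz : 2 < ‖z‖) : gradient σ z = 0 := by
  refine gradient_eq_zero_of_eventuallyEq_const (c := 0) ?_
  have ho : IsOpen {y : EuclideanSpace ℝ (Fin 3) | 2 < ‖y‖} := isOpen_lt continuous_const continuous_norm
  exact eventuallyEq_of_mem (ho.mem_nhds hz) fun y hy => hσzero y (le_of_lt hy)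

/-- **Outward Bernoulli flux makes the profile flux term non-positive.**  If `⟪w, ∇σ(z)⟫ = −k(z)⟪w, z⟫`
with `k ≥ 0`, `σ = 0` off `B_2`, `0 ≤ (|V(y)|² + 2P(y)) ⟪V(y), y⟫` for a.e. `|y| < r₀`, and the scale
is small, `2 (−τ)^{−γ} < r₀`, then `∫ (|V|² + 2P) ⟪V, ∇σ((−τ)^γ ·)⟫ ≤ 0`. [folklore] -/
theorem profileFlux_nonpos {k : EuclideanSpace ℝ (Fin 3) → ℝ} (hk : ∀ z, 0 ≤ k z)
    (hσk : ∀ z w : EuclideanSpace ℝ (Fin 3), ⟪w, gradient σ z⟫ = -(k z * ⟪w, z⟫))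
    (hσzero : ∀ z : EuclideanSpace ℝ (Fin 3), 2 ≤ ‖z‖ → σ z = 0)
    {r₀ : ℝ} (hout : ∀ᵐ y ∂(volume : Measure (EuclideanSpace ℝ (Fin 3))), ‖y‖ < r₀ →
      0 ≤ (‖V y‖ ^ 2 + 2 * P y) * ⟪V y, y⟫)
    {τ : ℝ} (hτ : τ < 0) (hτr : 2 * (-τ) ^ (-γ) < r₀) :
    ∫ y, (‖V y‖ ^ 2 + 2 * P y) * ⟪V y, gradient σ ((-τ) ^ γ • y)⟫ ≤ 0 := by
  have hs : 0 < -τ := neg_pos.2 hτ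
  have hc : 0 < (-τ) ^ γ := Real.rpow_pos_of_pos hs _
  refine integral_nonpos_of_ae ?_
  filter_upwards [hout] with y hy
  by_cases hyr : ‖y‖ < r₀
  · have h0 := hy hyr
    rw [hσk, inner_smul_right]
    have e : (‖V y‖ ^ 2 + 2 * P y) * -(k ((-τ) ^ γ • y) * ((-τ) ^ γ * ⟪V y, y⟫)) =
        -((k ((-τ) ^ γ • y) * (-τ) ^ γ) * ((‖V y‖ ^ 2 + 2 * P y) * ⟪V y, y⟫)) := by ring
    rw [e, Pi.zero_apply, neg_nonpos]
    exact mul_nonneg (mul_nonneg (hk _) hc.le) h0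
  · -- outside `B_{r₀}` the rescaled point lies outside `B̄_2`, where `∇σ = 0`
    rw [not_lt] at hyr
    have h2 : 2 < ‖(-τ) ^ γ • y‖ := by
      rw [norm_smul, Real.norm_of_nonneg hc.le]
      have h1 : 2 * (-τ) ^ (-γ) * (-τ) ^ γ = 2 := by
        rw [mul_assoc, ← Real.rpow_add hs, neg_add_cancel, Real.rpow_zero, mul_one]
      have hr₀ : 0 < r₀ := lt_of_le_of_lt (by positivity) hτr
      calc (2 : ℝ) = 2 * (-τ) ^ (-γ) * (-τ) ^ γ := h1.symm
        _ < r₀ * (-τ) ^ γ := mul_lt_mul_of_pos_right hτr hc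
        _ ≤ ‖y‖ * (-τ) ^ γ := mul_le_mul_of_nonneg_right hyr hc.le
        _ = (-τ) ^ γ * ‖y‖ := mul_comm _ _
    rw [gradient_eq_zero_of_two_lt hσzero h2, inner_zero_right, mul_zero, Pi.zero_apply]

/-- **Profile Liouville under outward Bernoulli flux (local form), any `γ > 0`.**  Let `σ` be a cutoff
as in `exists_radialCutoff` (`0 ≤ σ ≤ 1`, `σ = 1` on `B̄_1`, `σ = 0` off `B_2`, continuous, inward
gradient).  Suppose the profile pair `(V, P)` has `|V|² ∈ L¹_loc`, satisfies the forward profile local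
energy inequality for `σ` (the shape delivered by `selfSimilar_profile_energy_le_add_flux`), has
normalised enclosed energy `≤ ε` frequently in every far past, and has OUTWARD Bernoulli flux a.e. on
`B_{r₀}`: `0 ≤ (|V|² + 2P)⟪V, y⟫` for a.e. `|y| < r₀`.  Then `V = 0` a.e. on `B_{r₀/2}`.  Mechanism: for
`2(−τ)^{−γ} < r₀` the flux term is `≤ 0`, so the enclosed energy `Φ(τ)` is a.e. non-increasing in `τ`; it
is `≤ ε` frequently at `−∞`; hence `Φ = 0` a.e. below the threshold, i.e. `V = 0` a.e. on the balls
`B_{(−τ)^{−γ}}`, which exhaust `B_{r₀/2}`. [folklore] -/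
theorem profile_ae_eq_zero_of_outgoingFlux (hγ : 0 < γ)
    (hσ0 : ∀ z, 0 ≤ σ z) (hσle : ∀ z, σ z ≤ 1)
    (hσ1 : ∀ z : EuclideanSpace ℝ (Fin 3), ‖z‖ ≤ 1 → σ z = 1)
    (hσzero : ∀ z : EuclideanSpace ℝ (Fin 3), 2 ≤ ‖z‖ → σ z = 0) (hσc : Continuous σ)
    {k : EuclideanSpace ℝ (Fin 3) → ℝ} (hk : ∀ z, 0 ≤ k z)
    (hσk : ∀ z w : EuclideanSpace ℝ (Fin 3), ⟪w, gradient σ z⟫ = -(k z * ⟪w, z⟫))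
    (hV : AEStronglyMeasurable V volume)
    (hV2 : LocallyIntegrable (fun y => ‖V y‖ ^ 2) volume)
    (hLEI : ∀ᵐ τ₁ : ℝ, τ₁ < 0 → ∀ᵐ τ₂ : ℝ, τ₂ ∈ Ioo τ₁ 0 →
      (-τ₂) ^ (5 * γ - 2) * ∫ y, ‖V y‖ ^ 2 * σ ((-τ₂) ^ γ • y) ≤
        ((-τ₁) ^ (5 * γ - 2) * ∫ y, ‖V y‖ ^ 2 * σ ((-τ₁) ^ γ • y)) +
          ∫ τ in Ico τ₁ τ₂, (-τ) ^ (6 * γ - 3) *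
            ∫ y, (‖V y‖ ^ 2 + 2 * P y) * ⟪V y, gradient σ ((-τ) ^ γ • y)⟫)
    (hsmall : ∀ ε : ℝ, 0 < ε → ∀ T : ℝ, ∃ᵐ τ ∂(volume : Measure ℝ),
      τ < -T ∧ (-τ) ^ (5 * γ - 2) * ∫ y, ‖V y‖ ^ 2 * σ ((-τ) ^ γ • y) ≤ ε)
    {r₀ : ℝ} (hr₀ : 0 < r₀)
    (hout : ∀ᵐ y ∂(volume : Measure (EuclideanSpace ℝ (Fin 3))), ‖y‖ < r₀ →
      0 ≤ (‖V y‖ ^ 2 + 2 * P y) * ⟪V y, y⟫) :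
    ∀ᵐ y ∂(volume : Measure (EuclideanSpace ℝ (Fin 3))), ‖y‖ < r₀ / 2 → V y = 0 := by
  -- notation
  set Φ : ℝ → ℝ := fun τ => (-τ) ^ (5 * γ - 2) * ∫ y, ‖V y‖ ^ 2 * σ ((-τ) ^ γ • y) with hΦ
  -- the threshold `s₀ = (2/r₀)^{1/γ}`: for `τ < -s₀`, `2 (−τ)^{−γ} < r₀`
  set s₀ : ℝ := (2 / r₀) ^ (1 / γ) with hs₀
  have hs₀pos : 0 < s₀ := Real.rpow_pos_of_pos (by positivity) _
  have hscale : ∀ {s : ℝ}, 0 < s → (s ^ (1 / γ)) ^ (-γ) = s⁻¹ := by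
    intro s hs
    rw [← Real.rpow_mul hs.le, show 1 / γ * -γ = -1 by field_simp, Real.rpow_neg_one]
  have hthr : ∀ τ : ℝ, τ < -s₀ → 2 * (-τ) ^ (-γ) < r₀ := by
    intro τ hτ
    have hs : s₀ < -τ := by linarith
    have h1 : (-τ) ^ (-γ) < s₀ ^ (-γ) :=
      Real.rpow_lt_rpow_of_neg hs₀pos hs (by linarith)
    have h2 : s₀ ^ (-γ) = r₀ / 2 := by
      rw [hs₀, hscale (by positivity), inv_div]
    calc 2 * (-τ) ^ (-γ) < 2 * s₀ ^ (-γ) := by gcongr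
      _ = r₀ := by rw [h2]; ring
  -- (1) a.e. monotonicity of `Φ` below the threshold
  have hmono : ∀ᵐ τ₁ : ℝ, τ₁ < 0 → ∀ᵐ τ₂ : ℝ, τ₂ ∈ Ioo τ₁ 0 → τ₂ < -s₀ → Φ τ₂ ≤ Φ τ₁ := by
    filter_upwards [hLEI] with τ₁ hτ₁ hneg
    filter_upwards [hτ₁ hneg] with τ₂ hτ₂ hI hτ₂s
    have key := hτ₂ hI
    have hflux : ∫ τ in Ico τ₁ τ₂, (-τ) ^ (6 * γ - 3) *
        ∫ y, (‖V y‖ ^ 2 + 2 * P y) * ⟪V y, gradient σ ((-τ) ^ γ • y)⟫ ≤ 0 := by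
      refine setIntegral_nonpos measurableSet_Ico fun τ hτ => ?_
      have hτ0 : τ < 0 := by linarith [hτ.2, hI.2]
      have hτs : τ < -s₀ := by linarith [hτ.2]
      exact mul_nonpos_of_nonneg_of_nonpos (Real.rpow_nonneg (neg_pos.2 hτ0).le _)
        (profileFlux_nonpos hk hσk hσzero hout hτ0 (hthr τ hτs))
    simp only [hΦ]
    linarith [key, hflux]
  -- (2) `Φ ≤ 1/(n+1)` a.e. on a final segment below the threshold, for every `n`
  have hsmallae : ∀ n : ℕ, ∀ᵐ τ₂ : ℝ, τ₂ ∈ Ioo (-(s₀ + (n : ℝ) + 1)) (-s₀) →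
      Φ τ₂ ≤ 1 / ((n : ℝ) + 1) := by
    intro n
    have hε : (0 : ℝ) < 1 / ((n : ℝ) + 1) := by positivity
    obtain ⟨τ₁, ⟨hτ₁T, hΦτ₁⟩, hτ₁mono⟩ :=
      ((hsmall _ hε (s₀ + n + 1)).and_eventually hmono).exists
    have hτ₁0 : τ₁ < 0 := by linarith
    filter_upwards [hτ₁mono hτ₁0] with τ₂ hτ₂ hmem
    have hI : τ₂ ∈ Ioo τ₁ 0 := ⟨by linarith [hmem.1], by linarith [hmem.2]⟩
    exact (hτ₂ hI hmem.2).trans hΦτ₁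
  -- (3) hence `Φ τ₂ = 0` for a.e. `τ₂ < -s₀`
  have hzero : ∀ᵐ τ₂ : ℝ, τ₂ < -s₀ → Φ τ₂ = 0 := by
    rw [← ae_all_iff] at hsmallae
    filter_upwards [hsmallae] with τ₂ hτ₂ hlt
    have hτ₂0 : τ₂ < 0 := by linarith
    refine le_antisymm ?_ (profileEnergy_nonneg hσ0 hτ₂0)
    refine le_of_forall_pos_le_add fun δ hδ => ?_
    rw [zero_add]
    obtain ⟨n, hn⟩ := exists_nat_gt (max (1 / δ) (-τ₂ - s₀))
    have hn1 : 1 / δ < (n : ℝ) + 1 := by linarith [le_max_left (1 / δ) (-τ₂ - s₀)]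
    have hn2 : -τ₂ - s₀ < (n : ℝ) + 1 := by linarith [le_max_right (1 / δ) (-τ₂ - s₀)]
    have hmem : τ₂ ∈ Ioo (-(s₀ + (n : ℝ) + 1)) (-s₀) := ⟨by linarith, hlt⟩
    have hδ' : 1 / ((n : ℝ) + 1) ≤ δ := by
      rw [div_lt_iff₀ hδ] at hn1
      rw [div_le_iff₀ (by positivity)]
      linarith
    exact (hτ₂ n hmem).trans hδ'
  -- (4) at a good time `τ₂ < -s₀`, `V = 0` a.e. on `B_{(−τ₂)^{−γ}}`
  have hball : ∀ τ₂ : ℝ, τ₂ < -s₀ → Φ τ₂ = 0 →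
      ∀ᵐ y ∂(volume : Measure (EuclideanSpace ℝ (Fin 3))), ‖y‖ < (-τ₂) ^ (-γ) → V y = 0 := by
    intro τ₂ hτ₂s hΦ0
    have hτ₂0 : τ₂ < 0 := by linarith
    have hs : 0 < -τ₂ := neg_pos.2 hτ₂0
    have hc : 0 < (-τ₂) ^ γ := Real.rpow_pos_of_pos hs _
    have hcinv : (-τ₂) ^ (-γ) * (-τ₂) ^ γ = 1 := by
      rw [← Real.rpow_add hs, neg_add_cancel, Real.rpow_zero]
    have hint0 : ∫ y, ‖V y‖ ^ 2 * σ ((-τ₂) ^ γ • y) = 0 := by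
      have h := hΦ0
      simp only [hΦ, mul_eq_zero] at h
      exact h.resolve_left (Real.rpow_pos_of_pos hs _).ne'
    -- the integrand vanishes off the closed ball of radius `R = 2 (−τ₂)^{−γ}`
    set R : ℝ := 2 * (-τ₂) ^ (-γ) with hR
    have hoff : ∀ y : EuclideanSpace ℝ (Fin 3), y ∉ closedBall (0 : EuclideanSpace ℝ (Fin 3)) R →
        ‖V y‖ ^ 2 * σ ((-τ₂) ^ γ • y) = 0 := by
      intro y hy
      rw [mem_closedBall, dist_zero_right, not_le] at hy
      have h2 : 2 ≤ ‖(-τ₂) ^ γ • y‖ := by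
        rw [norm_smul, Real.norm_of_nonneg hc.le]
        have : R * (-τ₂) ^ γ = 2 := by rw [hR, mul_assoc, hcinv, mul_one]
        nlinarith [hy, hc]
      rw [hσzero _ h2, mul_zero]
    -- integrability
    have hmeas : AEStronglyMeasurable (fun y => ‖V y‖ ^ 2 * σ ((-τ₂) ^ γ • y)) volume :=
      (hV.norm.pow 2).mul (hσc.comp (continuous_const_smul _)).aestronglyMeasurable
    have hint : Integrable (fun y => ‖V y‖ ^ 2 * σ ((-τ₂) ^ γ • y)) volume := by
      have hK : IntegrableOn (fun y => ‖V y‖ ^ 2 * σ ((-τ₂) ^ γ • y))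
          (closedBall (0 : EuclideanSpace ℝ (Fin 3)) R) volume := by
        have h1 : IntegrableOn (fun y => ‖V y‖ ^ 2) (closedBall (0 : EuclideanSpace ℝ (Fin 3)) R)
            volume := hV2.integrableOn_isCompact (isCompact_closedBall 0 R)
        refine Integrable.mono' h1 hmeas.restrict (Eventually.of_forall fun y => ?_)
        rw [Real.norm_eq_abs, abs_mul, abs_of_nonneg (sq_nonneg _), abs_of_nonneg (hσ0 _)]
        exact mul_le_of_le_one_right (sq_nonneg _) (hσle _)
      have hU := hK.of_forall_sdiff_eq_zero MeasurableSet.univ fun y hy => hoff y hy.2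
      rwa [integrableOn_univ] at hU
    have hnn : 0 ≤ᵐ[volume] fun y => ‖V y‖ ^ 2 * σ ((-τ₂) ^ γ • y) :=
      Eventually.of_forall fun y => mul_nonneg (sq_nonneg _) (hσ0 _)
    have hae := (integral_eq_zero_iff_of_nonneg_ae hnn hint).1 hint0
    filter_upwards [hae] with y hy hyr
    have hσy : σ ((-τ₂) ^ γ • y) = 1 := by
      refine hσ1 _ ?_
      rw [norm_smul, Real.norm_of_nonneg hc.le]
      have : (-τ₂) ^ γ * ‖y‖ < (-τ₂) ^ γ * (-τ₂) ^ (-γ) := mul_lt_mul_of_pos_left hyr hc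
      rw [mul_comm ((-τ₂) ^ γ) ((-τ₂) ^ (-γ)), hcinv] at this
      exact this.le
    have h0 : ‖V y‖ ^ 2 = 0 := by simpa [hσy] using hy
    exact norm_eq_zero.1 (pow_eq_zero_iff two_ne_zero |>.1 h0)
  -- (5) exhaust `B_{r₀/2}` by such balls
  have hsub : ∀ r : ℝ, 0 < r → r < r₀ / 2 →
      ∀ᵐ y ∂(volume : Measure (EuclideanSpace ℝ (Fin 3))), ‖y‖ < r → V y = 0 := by
    intro r hr hrr
    -- good times `τ₂ ∈ (−r^{−1/γ}, −s₀)`: then `(−τ₂)^{−γ} > r`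
    set s₁ : ℝ := r⁻¹ ^ (1 / γ) with hs₁
    have hs₁s₀ : s₀ < s₁ := by
      rw [hs₀, hs₁]
      refine Real.rpow_lt_rpow (by positivity) ?_ (by positivity)
      have h : 2 / r₀ < 1 / r := by
        rw [div_lt_div_iff₀ hr₀ hr]
        linarith
      rwa [one_div] at h
    have hpos : 0 < volume (Ioo (-s₁) (-s₀)) := by
      rw [Real.volume_Ioo]
      exact ENNReal.ofReal_pos.2 (by linarith)
    have hnull : volume {τ : ℝ | ¬ (τ < -s₀ → Φ τ = 0)} = 0 := ae_iff.1 hzero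
    have hex : ∃ τ₂, τ₂ ∈ Ioo (-s₁) (-s₀) ∧ Φ τ₂ = 0 := by
      by_contra hcon
      have hsub' : Ioo (-s₁) (-s₀) ⊆ {τ : ℝ | ¬ (τ < -s₀ → Φ τ = 0)} :=
        fun τ hτ himp => hcon ⟨τ, hτ, himp hτ.2⟩
      exact hpos.ne' (measure_mono_null hsub' hnull)
    obtain ⟨τ₂, hτ₂mem, hΦ0⟩ := hex
    have hτ₂0 : τ₂ < 0 := by linarith [hτ₂mem.2]
    have hrad : r < (-τ₂) ^ (-γ) := by
      have hlt : -τ₂ < s₁ := by linarith [hτ₂mem.1]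
      have h1 : s₁ ^ (-γ) < (-τ₂) ^ (-γ) :=
        Real.rpow_lt_rpow_of_neg (neg_pos.2 hτ₂0) hlt (by linarith)
      have h2 : s₁ ^ (-γ) = r := by rw [hs₁, hscale (by positivity), inv_inv]
      rwa [h2] at h1
    filter_upwards [hball τ₂ hτ₂mem.2 hΦ0] with y hy hyr
    exact hy (hyr.trans hrad)
  -- radii `r_n ↑ r₀/2`
  have hseq : ∀ n : ℕ, ∀ᵐ y ∂(volume : Measure (EuclideanSpace ℝ (Fin 3))),
      ‖y‖ < r₀ / 2 * (1 - 1 / ((n : ℝ) + 2)) → V y = 0 := by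
    intro n
    have hn : (0 : ℝ) < 1 - 1 / ((n : ℝ) + 2) := by
      rw [sub_pos, div_lt_one (by positivity)]
      linarith
    refine hsub _ (by positivity) ?_
    have : 1 - 1 / ((n : ℝ) + 2) < 1 := by
      rw [sub_lt_self_iff]
      positivity
    calc r₀ / 2 * (1 - 1 / ((n : ℝ) + 2)) < r₀ / 2 * 1 := by gcongr
      _ = r₀ / 2 := mul_one _
  rw [← ae_all_iff] at hseq
  filter_upwards [hseq] with y hy hyr
  -- pick `n` with `‖y‖ < r₀/2 (1 − 1/(n+2))`
  have hgap : 0 < r₀ / 2 - ‖y‖ := by linarith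
  obtain ⟨n, hn⟩ := exists_nat_gt (r₀ / 2 / (r₀ / 2 - ‖y‖))
  refine hy n ?_
  have hn2 : r₀ / 2 / (r₀ / 2 - ‖y‖) < (n : ℝ) + 2 := by linarith
  rw [div_lt_iff₀ hgap] at hn2
  have e : r₀ / 2 * (1 - 1 / ((n : ℝ) + 2)) = r₀ / 2 - r₀ / 2 / ((n : ℝ) + 2) := by ring
  rw [e, lt_sub_iff_add_lt]
  have : r₀ / 2 / ((n : ℝ) + 2) < r₀ / 2 - ‖y‖ := by
    rw [div_lt_iff₀ (by positivity)]
    linarith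
  linarith

end Profile

end Summit.NavierStokesRegularity.NavierStokesRegularity.Theorems.PowerGaugeEulerLiouville

end
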